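import Summits.QuantumFields.YangMills.Theorems.BalabanLadderUVSeamRecUnitDilation
import HarnessLib

/-!
# Crux `UVSeamRec` (stmt-QuantumFields-20043), stub `stub_ceilings`: one-sided transfer of the ceilings between units

Helper file (`--supports stmt-QuantumFields-20043`) of the lead prover (unit `ym-spine-20043-p1`); the transport layer of
the CEILINGS stub, companion of `BalabanLadderUVSeamRecUnitDilation` (exact covariance) and of the floors transfer
`BalabanLadderUVSeamRecUnitTransfer*`.

The collar outputs `MomentBounds6 G r a` / `MomentBounds G r a` and the femto boundary laws `FBL6 G r a` / `FBL G r a`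
see the unit map `a` ONLY through an upper constraint on the collar radius (`R · a β ≤ ℓ₄`) resp. the femto-cube side
(`b · a β ≤ ℓ₁`).  Hence they pass from a unit `a` to ANY unit `u` with `a ≤ c · u` eventually (`c > 0`): the target
constraint `R · u β ≤ ℓ₄ / c` implies the source constraint.  This is the honest content of «asymptotic scaling
`a_B ≤ c · uRec` of the tuned flow» in the line of record for `stub_ceilings` (E0′ proved at Bałaban's own unit `a_B`,
then moved to the unit of record); it is ONE-SIDED (no ratio convergence needed), in contrast with the floors
(`UnitTransfer.lowerBounds_of_tendsto_div`).  The same statement was certified off-tree by ym-beyond-p4 g15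
(`SeamReshape.lean`, `momentBounds6_of_eventually_le`); this file lands it.

* `momentBounds6_of_eventually_le`, `momentBounds_of_eventually_le`, `fbl6_of_eventually_le`, `fbl_of_eventually_le`;
* `stubCeilings_of_engine` — the reshaped ceilings stub: plane-resolved ceilings for every lattice representation of
  `SU(2)` at representation-dependent units `a_r` with `a_r ≤ c_r · uRec` eventually ⇒ the conclusion of `stub_ceilings`.
-/

set_option autoImplicit false

noncomputable section

open MeasureTheory Filter Topology
open Literature.MathematicalPhysics.QuantumFieldTheory Literature.MathematicalPhysics.QuantumLattice
open Summit.QuantumFields.YangMills.Cruxes.OSLegsFromFemtoAndGap.DlrCollarTransfer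

namespace Summit.QuantumFields.YangMills.Cruxes.UVSeamRec.CeilingsTransfer

variable {G : Type} [Group G] [TopologicalSpace G] [IsTopologicalGroup G] [CompactSpace G]
  [MeasurableSpace G] [BorelSpace G]

/-- **Plane-resolved ceilings move to any eventually coarser unit**: `MomentBounds6 G r a`, `a ≤ c · u` eventually,
`c > 0` ⇒ `MomentBounds6 G r u` (same constant `C`, collar range `ℓ₄ / c`). [folklore] -/
theorem momentBounds6_of_eventually_le (r : LatticeRep G) {a u : ℝ → ℝ} {c : ℝ} (hc : 0 < c)
    (hle : ∀ᶠ β in atTop, a β ≤ c * u β) (h : MomentBounds6 G r a) : MomentBounds6 G r u := by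
  obtain ⟨C, β₄, ℓ₄, hℓ₄, hC, H⟩ := h
  obtain ⟨β₀, hβ₀⟩ := Filter.eventually_atTop.1 hle
  refine ⟨C, max β₄ β₀, ℓ₄ / c, div_pos hℓ₄ hc, hC, fun β hβ L n q x R hq hR hRu hRL hsep => ?_⟩
  have hβ₄ : β₄ ≤ β := (le_max_left _ _).trans hβ
  have hau : a β ≤ c * u β := hβ₀ β ((le_max_right _ _).trans hβ)
  refine H β hβ₄ L n q x R hq hR ?_ hRL hsep
  rw [le_div_iff₀ hc] at hRu
  have hR0 : (0 : ℝ) ≤ R := Nat.cast_nonneg R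
  calc (R : ℝ) * a β ≤ R * (c * u β) := mul_le_mul_of_nonneg_left hau hR0
    _ = R * u β * c := by ring
    _ ≤ ℓ₄ := hRu

/-- **Density ceilings move to any eventually coarser unit.** [folklore] -/
theorem momentBounds_of_eventually_le (r : LatticeRep G) {a u : ℝ → ℝ} {c : ℝ} (hc : 0 < c)
    (hle : ∀ᶠ β in atTop, a β ≤ c * u β) (h : MomentBounds G r a) : MomentBounds G r u := by
  obtain ⟨C, β₄, ℓ₄, hℓ₄, hC, H⟩ := h
  obtain ⟨β₀, hβ₀⟩ := Filter.eventually_atTop.1 hle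
  refine ⟨C, max β₄ β₀, ℓ₄ / c, div_pos hℓ₄ hc, hC, fun β hβ L n x R hR hRu hRL hsep => ?_⟩
  have hβ₄ : β₄ ≤ β := (le_max_left _ _).trans hβ
  have hau : a β ≤ c * u β := hβ₀ β ((le_max_right _ _).trans hβ)
  refine H β hβ₄ L n x R hR ?_ hRL hsep
  rw [le_div_iff₀ hc] at hRu
  have hR0 : (0 : ℝ) ≤ R := Nat.cast_nonneg R
  calc (R : ℝ) * a β ≤ R * (c * u β) := mul_le_mul_of_nonneg_left hau hR0
    _ = R * u β * c := by ring
    _ ≤ ℓ₄ := hRu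

/-- **The plane-resolved femto boundary law moves to any eventually coarser unit** (femto-cube side `ℓ₁ / c`). [folklore] -/
theorem fbl6_of_eventually_le (r : LatticeRep G) {a u : ℝ → ℝ} {c : ℝ} (hc : 0 < c)
    (hle : ∀ᶠ β in atTop, a β ≤ c * u β) (h : FBL6 G r a) : FBL6 G r u := by
  obtain ⟨C₁, β₁, ℓ₁, p, hℓ₁, hC₁, H⟩ := h
  obtain ⟨β₀, hβ₀⟩ := Filter.eventually_atTop.1 hle
  refine ⟨C₁, max β₁ β₀, ℓ₁ / c, p, div_pos hℓ₁ hc, hC₁, fun β hβ cc b hb η q x hq hx => ?_⟩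
  have hβ₁ : β₁ ≤ β := (le_max_left _ _).trans hβ
  have hau : a β ≤ c * u β := hβ₀ β ((le_max_right _ _).trans hβ)
  refine H β hβ₁ cc b ?_ η q x hq hx
  rw [le_div_iff₀ hc] at hb
  have hb0 : (0 : ℝ) ≤ b := Nat.cast_nonneg b
  calc (b : ℝ) * a β ≤ b * (c * u β) := mul_le_mul_of_nonneg_left hau hb0
    _ = b * u β * c := by ring
    _ ≤ ℓ₁ := hb

/-- **The density femto boundary law moves to any eventually coarser unit.** [folklore] -/
theorem fbl_of_eventually_le (r : LatticeRep G) {a u : ℝ → ℝ} {c : ℝ} (hc : 0 < c)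
    (hle : ∀ᶠ β in atTop, a β ≤ c * u β) (h : FBL G r a) : FBL G r u := by
  obtain ⟨C₁, β₁, ℓ₁, p, hℓ₁, hC₁, H⟩ := h
  obtain ⟨β₀, hβ₀⟩ := Filter.eventually_atTop.1 hle
  refine ⟨C₁, max β₁ β₀, ℓ₁ / c, p, div_pos hℓ₁ hc, hC₁, fun β hβ cc b hb η x hx => ?_⟩
  have hβ₁ : β₁ ≤ β := (le_max_left _ _).trans hβ
  have hau : a β ≤ c * u β := hβ₀ β ((le_max_right _ _).trans hβ)
  refine H β hβ₁ cc b ?_ η x hx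
  rw [le_div_iff₀ hc] at hb
  have hb0 : (0 : ℝ) ≤ b := Nat.cast_nonneg b
  calc (b : ℝ) * a β ≤ b * (c * u β) := mul_le_mul_of_nonneg_left hau hb0
    _ = b * u β * c := by ring
    _ ≤ ℓ₁ := hb

/-- Ratio convergence to a positive constant gives the one-sided comparison (`a ≤ 2c₀ · u` eventually). [folklore] -/
theorem eventually_le_of_tendsto_div {a u : ℝ → ℝ} {c₀ : ℝ} (hc₀ : 0 < c₀) (hu : ∀ β, 0 < u β)
    (hau : Tendsto (fun β => a β / u β) atTop (𝓝 c₀)) : ∀ᶠ β in atTop, a β ≤ (2 * c₀) * u β := by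
  have h : ∀ᶠ β in atTop, a β / u β < 2 * c₀ := hau.eventually (gt_mem_nhds (by linarith))
  filter_upwards [h] with β hβ
  have := (div_lt_iff₀ (hu β)).1 hβ
  exact this.le

/-- **The reshaped ceilings stub of the `UVSeamRec` skeleton** (skeleton shape, `SU(2)` Borel): plane-resolved ceilings
for every lattice representation `r` of `SU(2)` at SOME unit `a` (depending on `r`) with `a ≤ c · uRec` eventually
(`c > 0`) ⇒ the conclusion of the registered `stub_ceilings` verbatim.  The engine side (E0′ at Bałaban's unit, from
the fields `EndStatementBPrinted` / `EndpointExistence` / `IsDatumOfRecord₀` of `UV`) is NOT claimed here. [folklore] -/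
theorem stubCeilings_of_engine
    (heng : letI : MeasurableSpace (Matrix.specialUnitaryGroup (Fin 2) ℂ) := borel _
      haveI : BorelSpace (Matrix.specialUnitaryGroup (Fin 2) ℂ) := ⟨rfl⟩
      ∀ r : LatticeRep (Matrix.specialUnitaryGroup (Fin 2) ℂ), ∃ (a : ℝ → ℝ) (c : ℝ), 0 < c ∧
        (∀ᶠ β in atTop, a β ≤ c * Transport.uRec β) ∧ MomentBounds6 (Matrix.specialUnitaryGroup (Fin 2) ℂ) r a) :
    letI : MeasurableSpace (Matrix.specialUnitaryGroup (Fin 2) ℂ) := borel _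
    haveI : BorelSpace (Matrix.specialUnitaryGroup (Fin 2) ℂ) := ⟨rfl⟩
    ∀ r : LatticeRep (Matrix.specialUnitaryGroup (Fin 2) ℂ),
      MomentBounds6 (Matrix.specialUnitaryGroup (Fin 2) ℂ) r Transport.uRec := by
  letI : MeasurableSpace (Matrix.specialUnitaryGroup (Fin 2) ℂ) := borel _
  haveI : BorelSpace (Matrix.specialUnitaryGroup (Fin 2) ℂ) := ⟨rfl⟩
  intro r
  obtain ⟨a, c, hc, hle, hMB⟩ := heng r
  exact momentBounds6_of_eventually_le r hc hle hMB

end Summit.QuantumFields.YangMills.Cruxes.UVSeamRec.CeilingsTransfer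

end
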